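import Summits.Ventures.PackingBounds.Configurations.HexagonDesigns

/-!
# The hexagon 5-design family: `(1+t)^k`-energies for `k ≤ 5` and the member `D(1,1,1,1) = D₄`

Framing: lottery ticket; floor = certified bounds/negative ranges. Venture `PackingBounds` (cell
`pub-packcert`, seat `pub-packcert-energy`) — continuation of `HexagonDesigns.lean` (Cohn–Conway–Elkies–Kumar
2007, §4–§5): every member `D(a_0, …, a_3)` of the three-parameter family of 24-point 5-designs on `S³` has the
`D₄` root system's `(1+t)^k`-energy for `k ≤ 5` (`ckPow_energy_eq`: `528, 624, 816, 1128, 1608`), and at phases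
`a_m = 1` the configuration is a kissing configuration (`inner_le_half_of_phase_one`; it is the `D₄` root system).

## References
* H. Cohn, J. H. Conway, N. D. Elkies, A. Kumar, *The D₄ root system is not universally optimal*,
  Experiment. Math. 16 (2007) 313–320, §4–§5. [`CohnConwayElkiesKumar2007`]
-/

noncomputable section

namespace Summit.Ventures.PackingBounds.Config.HexagonDesigns

open Finset Literature.Analysis.SpecialFunctions Summit.Ventures.PackingBounds.Energy

/-- `(√3)² = 3`. -/
private theorem s3sq' : Real.sqrt 3 ^ 2 = 3 := Real.sq_sqrt (by norm_num)

section family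

variable {c s : Fin 4 → ℝ} (hcs : ∀ m, c m ^ 2 + s m ^ 2 = 1)
include hcs

/-- The zeroth moment: `Σ_{x,y ∈ D(a)} U_0 = 24² = 576`. -/
theorem moment_zero : ∑ x ∈ config c s, ∑ y ∈ config c s, gegenbauerSum 1 0 (inner ℝ x y) = 576 := by
  simp only [ChebyshevU.c1_0, sum_const, card_config hcs, nsmul_eq_mul]
  norm_num

/-- **Every member of the family has the `D₄` root system's `(1+t)^k`-energy for `k ≤ 5`** (a 5-design
minimises — indeed fixes — the energy of every polynomial potential of degree `≤ 5`; CCEK §5, "for `k ≤ 5` this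
follows immediately from the spherical design property"): `Σ_{x ≠ y ∈ D(a)} (1 + ⟨x,y⟩)^k = 528, 624, 816, 1128, 1608`
`= 24(8(1/2)^k + 6 + 8(3/2)^k)` for `k = 1, …, 5`. [cite: CohnConwayElkiesKumar2007, §5] -/
theorem ckPow_energy_eq (k : ℕ) (hk1 : 1 ≤ k) (hk5 : k ≤ 5) :
    ∑ x ∈ config c s, ∑ y ∈ (config c s).erase x, (1 + inner ℝ x y) ^ k =
      (24 : ℝ) * (8 * (1 / 2 : ℝ) ^ k + 6 + 8 * (3 / 2 : ℝ) ^ k) := by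
  classical
  have h1 := norm_of_mem_config hcs
  -- remove the diagonal: `Σ_{y ≠ x} f = Σ_y f - f(x,x)` with `⟨x,x⟩ = 1`
  have hdiag : ∀ x ∈ config c s, ∑ y ∈ (config c s).erase x, (1 + inner ℝ x y) ^ k =
      ∑ y ∈ config c s, (1 + inner ℝ x y) ^ k - 2 ^ k := by
    intro x hx
    rw [← Finset.sum_erase_add _ _ hx, real_inner_self_eq_norm_sq, h1 x hx]
    norm_num
  rw [Finset.sum_congr rfl hdiag, Finset.sum_sub_distrib, sum_const, card_config hcs, nsmul_eq_mul]
  have M0 := moment_zero hcs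
  have M1 := design5 hcs 1 (by norm_num) (by norm_num)
  have M2 := design5 hcs 2 (by norm_num) (by norm_num)
  have M3 := design5 hcs 3 (by norm_num) (by norm_num)
  have M4 := design5 hcs 4 (by norm_num) (by norm_num)
  have M5 := design5 hcs 5 (by norm_num) (by norm_num)
  interval_cases k
  · have hlin : ∀ x y : EuclideanSpace ℝ (Fin 4), (1 + inner ℝ x y) ^ 1 =
        1 * gegenbauerSum 1 0 (inner ℝ x y) + (1 / 2 : ℝ) * gegenbauerSum 1 1 (inner ℝ x y) := by
      intro x y; rw [ChebyshevU.c1_0, ChebyshevU.c1_1]; ring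
    simp_rw [hlin, Finset.sum_add_distrib, ← Finset.mul_sum, M0, M1]
    norm_num
  · have hlin : ∀ x y : EuclideanSpace ℝ (Fin 4), (1 + inner ℝ x y) ^ 2 =
        (5 / 4 : ℝ) * gegenbauerSum 1 0 (inner ℝ x y) + 1 * gegenbauerSum 1 1 (inner ℝ x y) +
          (1 / 4 : ℝ) * gegenbauerSum 1 2 (inner ℝ x y) := by
      intro x y; rw [ChebyshevU.c1_0, ChebyshevU.c1_1, ChebyshevU.c1_2]; ring
    simp_rw [hlin, Finset.sum_add_distrib, ← Finset.mul_sum, M0, M1, M2]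
    norm_num
  · have hlin : ∀ x y : EuclideanSpace ℝ (Fin 4), (1 + inner ℝ x y) ^ 3 =
        (7 / 4 : ℝ) * gegenbauerSum 1 0 (inner ℝ x y) + (7 / 4 : ℝ) * gegenbauerSum 1 1 (inner ℝ x y) +
          (3 / 4 : ℝ) * gegenbauerSum 1 2 (inner ℝ x y) + (1 / 8 : ℝ) * gegenbauerSum 1 3 (inner ℝ x y) := by
      intro x y; rw [ChebyshevU.c1_0, ChebyshevU.c1_1, ChebyshevU.c1_2, ChebyshevU.c1_3]; ring
    simp_rw [hlin, Finset.sum_add_distrib, ← Finset.mul_sum, M0, M1, M2, M3]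
    norm_num
  · have hlin : ∀ x y : EuclideanSpace ℝ (Fin 4), (1 + inner ℝ x y) ^ 4 =
        (21 / 8 : ℝ) * gegenbauerSum 1 0 (inner ℝ x y) + 3 * gegenbauerSum 1 1 (inner ℝ x y) +
          (27 / 16 : ℝ) * gegenbauerSum 1 2 (inner ℝ x y) + (1 / 2 : ℝ) * gegenbauerSum 1 3 (inner ℝ x y) +
          (1 / 16 : ℝ) * gegenbauerSum 1 4 (inner ℝ x y) := by
      intro x y
      rw [ChebyshevU.c1_0, ChebyshevU.c1_1, ChebyshevU.c1_2, ChebyshevU.c1_3, ChebyshevU.c1_4]; ring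
    simp_rw [hlin, Finset.sum_add_distrib, ← Finset.mul_sum, M0, M1, M2, M3, M4]
    norm_num
  · have hlin : ∀ x y : EuclideanSpace ℝ (Fin 4), (1 + inner ℝ x y) ^ 5 =
        (33 / 8 : ℝ) * gegenbauerSum 1 0 (inner ℝ x y) + (165 / 32 : ℝ) * gegenbauerSum 1 1 (inner ℝ x y) +
          (55 / 16 : ℝ) * gegenbauerSum 1 2 (inner ℝ x y) + (11 / 8 : ℝ) * gegenbauerSum 1 3 (inner ℝ x y) +
          (5 / 16 : ℝ) * gegenbauerSum 1 4 (inner ℝ x y) + (1 / 32 : ℝ) * gegenbauerSum 1 5 (inner ℝ x y) := by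
      intro x y
      rw [ChebyshevU.c1_0, ChebyshevU.c1_1, ChebyshevU.c1_2, ChebyshevU.c1_3, ChebyshevU.c1_4,
        ChebyshevU.c1_5]
      ring
    simp_rw [hlin, Finset.sum_add_distrib, ← Finset.mul_sum, M0, M1, M2, M3, M4, M5]
    norm_num

/-! ### `D(1,1,1,1)` is the kissing configuration `D₄` -/

omit hcs in
/-- At phases `a_m = 1` the `24` points are a kissing configuration: distinct points have inner product `≤ 1/2`
(in fact in `{-1, ±1/2, 0}`; `D(1,1,1,1)` is the `D₄` root system, CCEK §4, and by Musin's `k(4) = 24` an optimal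
kissing configuration of `ℝ⁴`). [cite: CohnConwayElkiesKumar2007, §4 (D(1,1,1,1) = C_{D_4})] -/
theorem inner_le_half_of_phase_one :
    ∀ x ∈ config (fun _ => 1) (fun _ => 0), ∀ y ∈ config (fun _ => 1) (fun _ => 0), x ≠ y →
      inner ℝ x y ≤ 1 / 2 := by
  classical
  have hcs1 : ∀ m : Fin 4, ((fun _ => (1 : ℝ)) m) ^ 2 + ((fun _ => (0 : ℝ)) m) ^ 2 = 1 := fun m => by norm_num
  intro x hx y hy hxy
  obtain ⟨⟨m, j⟩, _, rfl⟩ := mem_image.1 hx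
  obtain ⟨⟨m', j'⟩, _, rfl⟩ := mem_image.1 hy
  obtain ⟨d, rfl⟩ : ∃ d, j' = j + d := ⟨j' - j, by abel⟩
  rw [inner_pt_add]
  -- at phase `1` the block invariants are the base tables
  have hX : inner ℝ (rot 1 0 (hvec m.val)) (rot 1 0 (hvec m'.val)) = if m = m' then 1 else 0 := by
    rw [inner_rot_rot, inner_hvec]; ring
  have hY2 : bform (rot 1 0 (hvec m.val)) (rot 1 0 (hvec m'.val)) ^ 2 = if m = m' then 0 else 1 / 3 := by
    rw [bform_rot_rot, ← bform_hvec_sq m m']; ring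
  have h3 := s3sq'
  by_cases hm : m = m'
  · subst hm
    rw [if_pos rfl] at hX hY2
    have hY : bform (rot 1 0 (hvec m.val)) (rot 1 0 (hvec m.val)) = 0 := pow_eq_zero_iff (by norm_num) |>.mp hY2
    rw [hX, hY]
    have hd : d ≠ 0 := by rintro rfl; exact hxy (by simp)
    fin_cases d <;> simp [cos6, sin6] at hd ⊢ <;> norm_num
  · rw [if_neg hm] at hX hY2
    rw [hX, mul_zero, zero_add]
    have hzs : sin6 d.val ^ 2 ≤ 3 / 4 := by fin_cases d <;> simp [sin6] <;> nlinarith [h3]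
    nlinarith [sq_nonneg (sin6 d.val * bform (rot 1 0 (hvec m.val)) (rot 1 0 (hvec m'.val)) - 1 / 2),
      mul_le_mul_of_nonneg_right hzs (sq_nonneg (bform (rot 1 0 (hvec m.val)) (rot 1 0 (hvec m'.val))))]

end family

end Summit.Ventures.PackingBounds.Config.HexagonDesigns

end
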